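import Literature.NumberTheory.EllipticCurves.FineSelmerUpstairsUnipotentProofs
import Literature.NumberTheory.EllipticCurves.FineSelmerLimThm35AtTwoUpstairsProofs
import Summits.BirchSwinnertonDyer.BirchSwinnertonDyer.Theorems.AlignedTransportAtTwoMainConjectureOfRankZeroBSDAtTwoFineRoadLimRelUpstairs
import Summits.BirchSwinnertonDyer.BirchSwinnertonDyer.Theorems.AlignedTransportAtTwoMainConjectureOfRankZeroBSDAtTwoTorsionPointField
import Summits.BirchSwinnertonDyer.BirchSwinnertonDyer.Theorems.ByReductionTypeAtTwoOrdKatoHalfAtTwoIsoPosDiscEpsilonDefs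
import HarnessLib
/-!
# Route `ByReductionTypeAtTwo` (K4), crux 202 `OrdKatoHalfAtTwoIso` (stmt-BirchSwinnertonDyer-19573), line `steinberg-fibre-at-two`,
# registered research stub Q⁺ `FineSelmerConjATwoOrdPosDisc`: its two displayed classical-`μ` supply roads WITHOUT the Lim@2 print
# binder — Q⁺ ⟸ Iw⁺ (carrier `ℚ(W[2], √−1)`) and Q⁺ ⟸ `μ₂ = 0` on the SMALL carrier `ℚ(P, √−1)` — both KERNEL doors now
Seat `cruxlead-stmt-BirchSwinnertonDyer-19573-w2` GEN 6 (prover WIDTH under the LEAD lineage; HOME `run/shared/lean/pub/bsd-2adic/`;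
`--supports stmt-BirchSwinnertonDyer-19573`). HONEST FRAMING (cell bsd-2adic): THEOREMS ONLY — no definition, no named fact, no `sorry`;
the crux, its PAIR child 24097 and Q⁺ are NOT proved here; Q⁺ (Coates–Sujatha's Conjecture A at `2` on the cell) stays an OPEN `∀`-statement
whose input below is Iwasawa's classical `μ₂ = 0` on a NON-ABELIAN family (open); BSD is not proved by any of this.
WHY. Skeleton v19's displayed supply roads for Q⁺ — `conjA_two_posDisc_of_lim_of_classicalMu` (Iw⁺, carrier `ℚ(W[2], √−1)`) and
`conjA_two_posDisc_of_lim_of_classicalMu_pointField` (carrier the sextic `ℚ(P, √−1)`) — were BOTH conditional on the PRINT binder `hLim2`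
(Lim 2017 Thm. 3.5 at `2`, downstairs `L`-form; at these carriers its printed proof uses Iwasawa's 1973 ascent). This gen made the
UPSTAIRS form a tree theorem (`Lim2017.thm35_at_two_upstairs_fineSelmer_twoTorsion_finite_of_classicalMuVanishes_holds`, p716773) and typed
the unipotent variant over a totally complex base (`FineSelmerUpstairs.finite_primewiseFine_pTorsion_galImage_of_unipotent`, p717389, no ascent).
This file cashes both in:

* §1 (any number field `K`, any `p`) **`finite_pTorsion_fineRelaxed_of_primewise_upstairs`** — Lim's Lemma 3.2 descent for a NOT
  NECESSARILY NORMAL upstairs group `Ω` (`N ≤ Ω ≤ ker κ`, `N` normal of finite index in `ker κ`): if the classes of `H¹(Ω, E[p^∞])`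
  killed by `p` and dying on every `Ω ⊓ D_𝔓` are finite, then `Sel₀^{rel ∞}(K_∞, E[p^∞])[p]` is finite — the cell bsd-f1-sign2 kernel
  (`LimDescent.finite_pTorsion_of_resOfLe_maps`, generic) with the `p`-torsion kernel of the restriction bounded through the NORMAL CORE `N`
  (`LimDescent.finite_pTorsion_ker_resOfLe`), the relaxed fine classes restricting prime-wise
  (`FineSelmerUpstairs.resOfLe_decompositionSubgroup_eq_zero_of_forall_decomp`).
* §2 (any number field `K`, `p = 2`, `P ∈ E[2] ∖ 0`, `i² = −1`, carrier `F = K(P) ⊔ K⟮i⟯ = K̄^{Stab P} ⊔ K⟮i⟯`)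
  `exists_smul_twoTorsion_fixed_by_resGal` — `res(Γ_F)` fixes a CONJUGATE `σ₀ • P` (the restriction `Γ_F → Γ_K` is defined through a chosen
  embedding, `exists_mem_range_absGaloisRestrict_iff`; `Stab P` is open, `fixingSubgroup_fixedField_of_isOpen`), whence the unipotent flag
  `ℤ·(σ₀ • P) ⊂ E[2]` (`AlignedTransportAtTwoTorsionPointField.smul_sub_mem_zmultiples_of_smul_eq`); and
  **`exists_fineSelmerDualData_moduleFinite_of_classicalMu_pointField_adjoin`**: Iwasawa's `μ₂ = 0` for the cyclotomic `ℤ₂`-extensions of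
  `F` ⟹ statement (A) at `(E, 2)` DOWNSTAIRS over `K_∞` in the `∃ γ D` form (upstairs prime-wise finiteness over `galImage(ker κ_F)`; §1 with
  `N = ker ρ̄_{E,2} ⊓ ker χ₂`; `LimRelUpstairs.finite_pTorsion_fineSelmer_of_relaxed`; `exists_fineSelmerDualData_moduleFinite_iff_finite_pTorsion`).
* §3 (`K = ℚ`, the cell) the two doors BY NAME of the route's texts (p699544 `…PosDiscEpsilonDefs`):
  **`fineSelmerConjATwoOrdPosDisc_of_classicalMuTwo : ClassicalMuTwoDivisionFieldAdjoinIOrdPosDisc → FineSelmerConjATwoOrdPosDisc`** (Q⁺ ⟸ Iw⁺,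
  via `LimRelUpstairs.exists_fineSelmerDualData_moduleFinite_of_lim2017 …_holds`) and
  **`fineSelmerConjATwoOrdPosDisc_of_classicalMu_pointField_adjoin_I`** (Q⁺ ⟸ «∀ cell `W` ∃ `P ≠ 0`, `i`: `μ₂ = 0` along the cyclotomic
  `ℤ₂`-extensions of `ℚ(P, i)`» — the lead's `conjA_two_posDisc_of_lim_of_classicalMu_pointField` hypothesis VERBATIM, minus `hLim2`).

References: [Lim2017FineSelmer] §3 Lemma 3.2, Thm. 3.5; [CoatesSujatha2005] Conj. A, §3 Thm. 3.4, Lemma 3.3; [Iwasawa1973MuInvariants] §1;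
[SerreGaloisCohomology1997] I §2.6; [SilvermanAEC2009] III.6.4, VIII.§1; [MilneFT2022] Ch. 7; tree p699544, p706268, p716255, p716773, p717389.
-/

set_option autoImplicit false
-- the Theorems namespace of this sub repeats the summit name by design (D-0017 nested layout)
set_option linter.dupNamespace false

noncomputable section

open scoped Classical

namespace Summit.BirchSwinnertonDyer.BirchSwinnertonDyer.Theorems.SteinbergFibreAtTwo.PointFieldMu

open WeierstrassCurve NumberField IsDedekindDomain Field
open Literature.NumberTheory.EllipticCurves Literature.NumberTheory.EllipticCurves.GreenbergSelmer
  Literature.NumberTheory.GaloisRepresentations Literature.NumberTheory.IwasawaTheory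
  Literature.NumberTheory.EllipticCurves.Rank1Residual
open Summit.BirchSwinnertonDyer.BirchSwinnertonDyer.Theorems.AlignedTransportAtTwoFineRoad
open Summit.BirchSwinnertonDyer.BirchSwinnertonDyer.Theorems.AlignedTransportAtTwoTorsionPointField

/-! ## §1 Lim's Lemma 3.2 descent for a not necessarily normal upstairs group, prime-wise form -/

section Descent

variable {K : Type} [Field K] [NumberField K] (W : WeierstrassCurve K) [W.IsElliptic] (p : ℕ) [Fact p.Prime]
  (κ : ZpExtension K p)

/-- **DESCENT (Lim 2017, Lemma 3.2) for a not necessarily normal upstairs group.** `κ` a `ℤ_p`-extension of the number field `K`,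
`N ≤ Ω ≤ ker κ` subgroups of `Γ_K` with `N` NORMAL in `Γ_K` and of finite index in `ker κ` (`Ω` itself need not be normal — e.g.
`Ω = Gal(K̄/K(P)·K_∞)` for a `2`-torsion point `P`, `N = Gal(K̄/K(E[2], μ_{2^∞}))`). If the classes of `H¹(Ω, E[p^∞])` killed by `p` that
restrict to zero on `Ω ⊓ D_𝔓` for every maximal ideal `𝔓 ⊂ \bar ℤ_K` form a finite set, then `Sel₀^{rel ∞}(K_∞, E[p^∞])[p]` is finite:
the `p`-torsion kernel of `res : H¹(ker κ) → H¹(Ω)` lies in that of `res : H¹(ker κ) → H¹(N)`, finite by `p`-torsion inflation–restriction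
at the NORMAL `N` (`LimDescent.finite_pTorsion_ker_resOfLe`); relaxed fine classes restrict to prime-wise fine classes
(`FineSelmerUpstairs.resOfLe_decompositionSubgroup_eq_zero_of_forall_decomp`); fibre counting (`LimDescent.finite_pTorsion_of_resOfLe_maps`).
[cite: Lim2017FineSelmer, §3 Lemma 3.2 (arXiv:1306.2047 p. 6)] [cite: SerreGaloisCohomology1997, I §2.6 (inflation–restriction)] -/
theorem finite_pTorsion_fineRelaxed_of_primewise_upstairs
    {Ω N : Subgroup (absoluteGaloisGroup K)} [N.Normal] (hNΩ : N ≤ Ω) (hΩ : Ω ≤ κ.kerSubgroup)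
    (hind : (N.subgroupOf κ.kerSubgroup).FiniteIndex)
    (hup : Set.Finite {c : W.subgroupH1 p Ω |
      (∀ 𝔓 : Ideal (absIntegers (𝓞 K) K), 𝔓.IsMaximal →
        W.resOfLe p (inf_le_left : Ω ⊓ 𝔓.decompositionSubgroup (absoluteGaloisGroup K) ≤ Ω) c = 0) ∧ p • c = 0}) :
    Set.Finite {s : W.fineSelmerInftyRelaxedInf κ | p • s = 0} := by
  -- the `p`-torsion kernel of `res : H¹(ker κ) → H¹(Ω)`, bounded through `N`
  have hkerN : Set.Finite {c : W.subgroupH1 p κ.kerSubgroup | p • c = 0 ∧ W.resOfLe p (hNΩ.trans hΩ) c = 0} :=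
    LimDescent.finite_pTorsion_ker_resOfLe (M := W.geomPrimaryTorsion p) (hNΩ.trans hΩ)
      (fun g _ x hx ↦ by simpa [mul_assoc] using (inferInstance : N.Normal).conj_mem x hx g⁻¹) hind
      (fun m ↦ W.continuous_smul_geomPrimaryTorsion p m) p
      (LimDescent.finite_modN_fixedPoints_geomPrimaryTorsion W p N) (LimDescent.finite_pTorsion_geomPrimaryTorsion W p)
  have hker : Set.Finite {c : W.subgroupH1 p κ.kerSubgroup | p • c = 0 ∧ W.resOfLe p hΩ c = 0} := by
    refine hkerN.subset ?_
    rintro c ⟨hpc, hc⟩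
    refine ⟨hpc, ?_⟩
    have e := congrArg (fun f ↦ f c) (W.resOfLe_comp_holds p hNΩ hΩ)
    simp only [AddMonoidHom.comp_apply] at e
    rw [← e, hc, map_zero]
  -- the prime-wise fine classes over `Ω`
  let S₂ : AddSubgroup (W.subgroupH1 p Ω) :=
    { carrier := {c | ∀ 𝔓 : Ideal (absIntegers (𝓞 K) K), 𝔓.IsMaximal →
        W.resOfLe p (inf_le_left : Ω ⊓ 𝔓.decompositionSubgroup (absoluteGaloisGroup K) ≤ Ω) c = 0}
      add_mem' := fun {a b} ha hb 𝔓 h𝔓 ↦ by rw [map_add, ha 𝔓 h𝔓, hb 𝔓 h𝔓, add_zero]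
      zero_mem' := fun 𝔓 _ ↦ map_zero _
      neg_mem' := fun {a} ha 𝔓 h𝔓 ↦ by rw [map_neg, ha 𝔓 h𝔓, neg_zero] }
  have hmap : ∀ c ∈ W.fineSelmerInftyRelaxedInf κ, W.resOfLe p hΩ c ∈ S₂ := by
    intro c hc 𝔓 h𝔓
    have hc' := (mem_strictSelmerGroupOverRelaxedInf_iff (H := κ.kerSubgroup) (M := W.geomPrimaryTorsion p)
      (L := fineData (W.geomPrimaryTorsion p) p) c).1 hc
    have hloc : ∀ (v : HeightOneSpectrum (𝓞 K)) (σ : absoluteGaloisGroup K),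
        resOfLe (W.geomPrimaryTorsion p) (inf_le_left : κ.kerSubgroup ⊓ decomp v ≤ κ.kerSubgroup)
          (W.conjH1 p κ.kerSubgroup σ c) = 0 := by
      intro v σ
      by_cases hv : ((p : ℕ) : 𝓞 K) ∈ v.asIdeal
      · exact (FineSelmerCoefficientMap.mem_strictKer_fineLocalDatum_iff _ v _).1 (hc'.2 v hv σ)
      · exact hc'.1 v hv σ
    have h0 : W.resOfLe p (inf_le_left :
        κ.kerSubgroup ⊓ 𝔓.decompositionSubgroup (absoluteGaloisGroup K) ≤ κ.kerSubgroup) c = 0 :=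
      FineSelmerUpstairs.resOfLe_decompositionSubgroup_eq_zero_of_forall_decomp κ.kerSubgroup hloc 𝔓
    have hle1 : Ω ⊓ 𝔓.decompositionSubgroup (absoluteGaloisGroup K) ≤
        κ.kerSubgroup ⊓ 𝔓.decompositionSubgroup (absoluteGaloisGroup K) := inf_le_inf_right _ hΩ
    have e1 := congrArg (fun f ↦ f c)
      (W.resOfLe_comp_holds p (inf_le_left : Ω ⊓ 𝔓.decompositionSubgroup (absoluteGaloisGroup K) ≤ Ω) hΩ)
    have e2 := congrArg (fun f ↦ f c) (W.resOfLe_comp_holds p hle1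
      (inf_le_left : κ.kerSubgroup ⊓ 𝔓.decompositionSubgroup (absoluteGaloisGroup K) ≤ κ.kerSubgroup))
    simp only [AddMonoidHom.comp_apply] at e1 e2
    rw [e1, ← e2, h0, map_zero]
  have hmain := LimDescent.finite_pTorsion_of_resOfLe_maps (M := W.geomPrimaryTorsion p) hΩ p
    (W.fineSelmerInftyRelaxedInf κ) S₂ hmap hup hker
  refine Set.Finite.of_finite_image (hmain.subset ?_) Subtype.coe_injective.injOn
  rintro _ ⟨s, hs, rfl⟩
  refine ⟨s.2, ?_⟩
  have hs' : p • s = 0 := hs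
  rw [← AddSubmonoidClass.coe_nsmul, hs', ZeroMemClass.coe_zero]

end Descent

/-! ## §2 The small carrier `F = K(P) ⊔ K⟮i⟯`: statement (A) at `(E, 2)` downstairs from `μ₂(F^{cyc}) = 0` -/

section PointField

variable {K : Type} [Field K] [NumberField K] (W : WeierstrassCurve K) [W.IsElliptic]

omit [NumberField K] [W.IsElliptic] in
/-- The stabiliser of a torsion point (for the action on `E[n]`) is the stabiliser of the underlying geometric point, hence OPEN.
[cite: SilvermanAEC2009, VIII.§1 (action of G_{K̄/K} on E[m])] -/
theorem isOpen_stabilizer_geomTorsion {n : ℤ} (P : geomTorsion W n) :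
    IsOpen ((MulAction.stabilizer (absoluteGaloisGroup K) P : Subgroup (absoluteGaloisGroup K)) :
      Set (absoluteGaloisGroup K)) := by
  have h : (MulAction.stabilizer (absoluteGaloisGroup K) P : Subgroup (absoluteGaloisGroup K)) =
      MulAction.stabilizer (absoluteGaloisGroup K) (P : geomPoints W) := by
    ext σ
    simp only [MulAction.mem_stabilizer_iff]
    rw [Subtype.ext_iff, AddSubgroup.torsionBy.coe_smul]
  rw [h]
  exact W.isOpen_stabilizer_point_holds (P : geomPoints W)

omit [W.IsElliptic] in
/-- **`res(Γ_F)` fixes a CONJUGATE of `P`, for the carrier `F = K̄^{Stab P} ⊔ K⟮i⟯`.** The restriction `res : Γ_F → Γ_K` is defined through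
a chosen embedding, so `res(Γ_F) = Gal(K̄/e(F))` for SOME `K`-embedding `e : F → K̄` (`exists_mem_range_absGaloisRestrict_iff`); extending `e`
to `σ₀ ∈ Γ_K` (`AlgHom.liftNormal`), every `g ∈ res(Γ_F)` has `σ₀⁻¹ g σ₀` fixing `K̄^{Stab P}` pointwise, i.e. lying in `Stab P` (Galois
correspondence for the OPEN subgroup `Stab P`, `fixingSubgroup_fixedField_of_isOpen`), i.e. `g` fixes `σ₀ • P`. (For `K(P)/K` normal one may
take `σ₀ = 1`; on the `S₃` cell `K(P)` is a non-Galois cubic.) [cite: MilneFT2022, Ch. 7 (restriction to a subfield; the Galois correspondence)]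
[cite: SilvermanAEC2009, VIII.§1] -/
theorem exists_smul_twoTorsion_fixed_by_resGal (P : geomTorsion W 2) (i : AlgebraicClosure K) :
    ∃ σ₀ : absoluteGaloisGroup K, ∀ τ : absoluteGaloisGroup
        ↥(IntermediateField.fixedField (MulAction.stabilizer (absoluteGaloisGroup K) P) ⊔
          IntermediateField.adjoin K ({i} : Set (AlgebraicClosure K))),
      resGal (K := K) ↥(IntermediateField.fixedField (MulAction.stabilizer (absoluteGaloisGroup K) P) ⊔
          IntermediateField.adjoin K ({i} : Set (AlgebraicClosure K))) τ • (σ₀ • P) = σ₀ • P := by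
  haveI : Algebra.IsAlgebraic K ↥(IntermediateField.fixedField (MulAction.stabilizer (absoluteGaloisGroup K) P) ⊔
      IntermediateField.adjoin K ({i} : Set (AlgebraicClosure K))) := inferInstance
  obtain ⟨e, he⟩ := exists_mem_range_absGaloisRestrict_iff K
    ↥(IntermediateField.fixedField (MulAction.stabilizer (absoluteGaloisGroup K) P) ⊔
      IntermediateField.adjoin K ({i} : Set (AlgebraicClosure K)))
  -- extend `e` to an automorphism `σ₀` of `K̄`
  let eL : AlgebraicClosure K →ₐ[K] AlgebraicClosure K := e.liftNormal (AlgebraicClosure K)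
  have heL : ∀ x : ↥(IntermediateField.fixedField (MulAction.stabilizer (absoluteGaloisGroup K) P) ⊔
      IntermediateField.adjoin K ({i} : Set (AlgebraicClosure K))), eL (x : AlgebraicClosure K) = e x := fun x ↦ by
    have h := e.liftNormal_commutes (AlgebraicClosure K) x
    simpa using h
  let σ₀' : AlgebraicClosure K ≃ₐ[K] AlgebraicClosure K :=
    AlgEquiv.ofBijective eL (Algebra.IsAlgebraic.algHom_bijective eL)
  have hσ₀' : ∀ x, σ₀' x = eL x := fun _ ↦ rfl
  let σ₀ : absoluteGaloisGroup K := (absoluteGaloisGroup.toAlgEquiv K).symm σ₀'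
  have hσ₀ : absoluteGaloisGroup.toAlgEquiv K σ₀ = σ₀' := (absoluteGaloisGroup.toAlgEquiv K).apply_symm_apply σ₀'
  refine ⟨σ₀, fun τ ↦ ?_⟩
  have hfix := (he (resGal (K := K) _ τ)).1 ⟨τ, rfl⟩
  -- `σ₀⁻¹ · res τ · σ₀` fixes `K̄^{Stab P}` pointwise, hence stabilises `P`
  have hfixpt : ∀ x ∈ IntermediateField.fixedField (MulAction.stabilizer (absoluteGaloisGroup K) P),
      (σ₀⁻¹ * resGal (K := K) _ τ * σ₀) • x = x := by
    intro x hx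
    have hxF : x ∈ IntermediateField.fixedField (MulAction.stabilizer (absoluteGaloisGroup K) P) ⊔
        IntermediateField.adjoin K ({i} : Set (AlgebraicClosure K)) :=
      (le_sup_left (a := IntermediateField.fixedField (MulAction.stabilizer (absoluteGaloisGroup K) P))
        (b := IntermediateField.adjoin K ({i} : Set (AlgebraicClosure K)))) hx
    have h1 : resGal (K := K) _ τ • e ⟨x, hxF⟩ = e ⟨x, hxF⟩ := hfix ⟨x, hxF⟩
    have h2 : σ₀ • x = (e ⟨x, hxF⟩ : AlgebraicClosure K) := by
      rw [absoluteGaloisGroup.smul_def, hσ₀, hσ₀']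
      exact heL ⟨x, hxF⟩
    rw [mul_smul, mul_smul, h2, h1, ← h2, inv_smul_smul]
  have hstab : σ₀⁻¹ * resGal (K := K) _ τ * σ₀ ∈ MulAction.stabilizer (absoluteGaloisGroup K) P := by
    have hfs := fixingSubgroup_fixedField_of_isOpen (MulAction.stabilizer (absoluteGaloisGroup K) P)
      (isOpen_stabilizer_geomTorsion W P)
    rw [SetLike.ext_iff] at hfs
    refine (hfs _).1 ?_
    refine (IntermediateField.mem_fixingSubgroup_iff _
      (absoluteGaloisGroup.toAlgEquiv K (σ₀⁻¹ * resGal (K := K) _ τ * σ₀))).2 fun x hx ↦ ?_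
    rw [← absoluteGaloisGroup.smul_def]
    exact hfixpt x hx
  rw [MulAction.mem_stabilizer_iff, mul_smul, mul_smul, inv_smul_eq_iff] at hstab
  exact hstab

omit [NumberField K] in
/-- `ker ρ̄_{E,2} ⊓ ker χ₂` has finite index in `ker κ` for a cyclotomic `κ` (any number field; the `ℚ` case is
`LimRelUpstairs.finiteIndex_upstairs_subgroupOf`). [cite: Washington1997, §13.1] [cite: SilvermanAEC2009, VIII.§1] -/
theorem finiteIndex_upstairs_subgroupOf' (κ : ZpExtension K 2) (hκ : κ.IsCyclotomic) :
    (((W.galoisRepTorsion 2).ker ⊓ (GaloisRep.cyclotomicCharacter K 2).toMonoidHom.ker).subgroupOf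
      κ.kerSubgroup).FiniteIndex := by
  haveI := LimRelUpstairs.finiteIndex_ker_galoisRepTorsion W (n := 2) two_ne_zero
  haveI := InfRes.finiteIndex_ker_cyclotomicCharacter κ hκ
  have h : ((W.galoisRepTorsion 2).ker ⊓ (GaloisRep.cyclotomicCharacter K 2).toMonoidHom.ker).subgroupOf
      κ.kerSubgroup = ((W.galoisRepTorsion 2).ker).subgroupOf κ.kerSubgroup ⊓
        ((GaloisRep.cyclotomicCharacter K 2).toMonoidHom.ker).subgroupOf κ.kerSubgroup := by
    ext x
    simp only [Subgroup.mem_subgroupOf, Subgroup.mem_inf]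
  have e : (W.galoisRepTorsion ((2 : ℕ) : ℤ)).ker = (W.galoisRepTorsion 2).ker := rfl
  rw [e] at *
  rw [h]
  infer_instance

/-- **Statement (A) at `(E, 2)` DOWNSTAIRS from Iwasawa's `μ₂ = 0` on the SMALL carrier `F = K(P) ⊔ K⟮i⟯`** (`E = W/K` elliptic over a number
field, `P ∈ E[2] ∖ 0`, `i² = −1`; `F = K̄^{Stab P} ⊔ K⟮i⟯` is totally complex and `res(Γ_F)` acts on `E[2]` unipotently with flag
`ℤ·(σ₀ • P)`): if every cyclotomic `ℤ₂`-extension of `F` has classical `μ = 0`, then for every cyclotomic `ℤ₂`-extension `κ` of `K` some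
fine Selmer dual datum of `E` over `K_∞` is finitely generated over `ℤ₂` (`∃ γ D` form). Chain: upstairs prime-wise finiteness over
`galImage(ker κ_F)` (`FineSelmerUpstairs.finite_primewiseFine_pTorsion_galImage_of_unipotent`) → §1 with `N = ker ρ̄_{E,2} ⊓ ker χ₂ ≤ galImage(ker κ_F)`
(an element fixing `E[2]` and `μ_{2^∞}` fixes `e(F) ⊆ K(E[2], i)` and has `χ₂ = 1 ∈ μ(ℤ₂)`) → `Sel₀^{rel ∞}[2]` finite → `Sel₀[2]` finite
(`LimRelUpstairs.finite_pTorsion_fineSelmer_of_relaxed`) → `∃ γ D` (`exists_fineSelmerDualData_moduleFinite_iff_finite_pTorsion`). NO Lim@2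
named fact, NO Iwasawa ascent. [cite: Lim2017FineSelmer, §3 Thm. 3.5 (hypothesis on L) and Lemma 3.2] [cite: CoatesSujatha2005, statement (A), Thm. 3.4]
[cite: Iwasawa1973MuInvariants, §1 (the input; Thm. 2/3 not used)] -/
theorem exists_fineSelmerDualData_moduleFinite_of_classicalMu_pointField_adjoin {P : geomTorsion W 2} (hP : P ≠ 0)
    {i : AlgebraicClosure K} (hi : i ^ 2 = -1)
    (hμ : ∀ κF : ZpExtension ↥(IntermediateField.fixedField (MulAction.stabilizer (absoluteGaloisGroup K) P) ⊔
        IntermediateField.adjoin K ({i} : Set (AlgebraicClosure K))) 2, κF.IsCyclotomic → ClassicalMuVanishes κF)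
    (κ : ZpExtension K 2) (hκ : κ.IsCyclotomic) :
    ∃ (γ : absoluteGaloisGroup K) (D : W.FineSelmerDualData κ γ),
      Module.Finite ℤ_[2] (RestrictScalars ℤ_[2] (IwasawaAlgebra 2) D.X) := by
  haveI : Fact (Nat.Prime 2) := ⟨Nat.prime_two⟩
  haveI : NeZero ((2 : ℕ) : K) := ⟨by exact_mod_cast (two_ne_zero : (2 : K) ≠ 0)⟩
  -- the carrier `F`: a totally complex number field
  have hint : IsIntegral K i := by
    refine ⟨Polynomial.X ^ 2 + 1, Polynomial.monic_X_pow_add_C _ two_ne_zero, ?_⟩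
    simp [hi]
  haveI := IntermediateField.adjoin.finiteDimensional hint
  haveI := finiteDimensional_fixedField_stabilizer W P
  haveI : NumberField ↥(IntermediateField.fixedField (MulAction.stabilizer (absoluteGaloisGroup K) P) ⊔
      IntermediateField.adjoin K ({i} : Set (AlgebraicClosure K))) := NumberField.of_module_finite K _
  have hFc : ∀ w : InfinitePlace ↥(IntermediateField.fixedField (MulAction.stabilizer (absoluteGaloisGroup K) P) ⊔
      IntermediateField.adjoin K ({i} : Set (AlgebraicClosure K))), w.IsComplex :=
    FineSelmerUpstairs.isComplex_of_mem_sq_eq_neg_one i hi _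
      ((le_sup_right : IntermediateField.adjoin K ({i} : Set (AlgebraicClosure K)) ≤ _)
        (IntermediateField.mem_adjoin_simple_self K i))
  -- a cyclotomic `ℤ₂`-extension of `F`
  obtain ⟨κF, hκF⟩ := ZpExtension.exists_isCyclotomic_holds
    (↥(IntermediateField.fixedField (MulAction.stabilizer (absoluteGaloisGroup K) P) ⊔
      IntermediateField.adjoin K ({i} : Set (AlgebraicClosure K)))) 2 (GaloisRep.cyclotomicCharacter_range_infinite _ 2)
  -- the unipotent flag `ℤ·(σ₀ • P)`
  obtain ⟨σ₀, hσ₀⟩ := exists_smul_twoTorsion_fixed_by_resGal W P i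
  have hP' : σ₀ • P ≠ 0 := fun h ↦ hP (by rw [← inv_smul_smul σ₀ P, h, smul_zero])
  set C : AddSubgroup (geomTorsion W ((2 : ℕ) : ℤ)) := AddSubgroup.zmultiples (σ₀ • P) with hC
  have hC1 : ∀ (τ : absoluteGaloisGroup ↥(IntermediateField.fixedField (MulAction.stabilizer (absoluteGaloisGroup K) P) ⊔
      IntermediateField.adjoin K ({i} : Set (AlgebraicClosure K)))) (Q : geomTorsion W ((2 : ℕ) : ℤ)),
      Q ∈ C → resGal (K := K) _ τ • Q = Q := by
    intro τ Q hQ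
    obtain ⟨k, rfl⟩ := AddSubgroup.mem_zmultiples_iff.mp hQ
    rw [show resGal (K := K) _ τ • (k • (σ₀ • P)) = k • (resGal (K := K) _ τ • (σ₀ • P)) from
      map_zsmul (DistribSMul.toAddMonoidHom (geomTorsion W ((2 : ℕ) : ℤ)) (resGal (K := K) _ τ)) k (σ₀ • P), hσ₀ τ]
  have hC2 : ∀ (τ : absoluteGaloisGroup ↥(IntermediateField.fixedField (MulAction.stabilizer (absoluteGaloisGroup K) P) ⊔
      IntermediateField.adjoin K ({i} : Set (AlgebraicClosure K)))) (Q : geomTorsion W ((2 : ℕ) : ℤ)),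
      resGal (K := K) _ τ • Q - Q ∈ C :=
    fun τ Q ↦ smul_sub_mem_zmultiples_of_smul_eq hP' (hσ₀ τ) Q
  -- upstairs, prime-wise, over `Ω = galImage(ker κ_F)`
  have hup := FineSelmerUpstairs.finite_primewiseFine_pTorsion_galImage_of_unipotent W hFc C hC1 hC2 κF hκF (hμ κF hκF)
  -- `N = ker ρ̄_{E,2} ⊓ ker χ₂ ≤ Ω ≤ ker κ`
  have hkerF := FineSelmerFiniteOfUnramifiedClasses.kerSubgroup_eq_comap_of_isCyclotomic κ hκ κF hκF
  have hΩ : BaseChangeModel.galImage K _ κF.kerSubgroup ≤ κ.kerSubgroup := by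
    unfold BaseChangeModel.galImage
    rw [resGal_eq_absGaloisRestrict, hkerF]
    exact Subgroup.map_comap_le _ _
  obtain ⟨e, he⟩ := exists_mem_range_absGaloisRestrict_iff K
    ↥(IntermediateField.fixedField (MulAction.stabilizer (absoluteGaloisGroup K) P) ⊔
      IntermediateField.adjoin K ({i} : Set (AlgebraicClosure K)))
  have hNΩ : (W.galoisRepTorsion 2).ker ⊓ (GaloisRep.cyclotomicCharacter K 2).toMonoidHom.ker ≤
      BaseChangeModel.galImage K _ κF.kerSubgroup := by
    intro g hg
    obtain ⟨hρ, hχ⟩ := Subgroup.mem_inf.1 hg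
    rw [MonoidHom.mem_ker] at hρ hχ
    change GaloisRep.cyclotomicCharacter K 2 g = 1 at hχ
    have hρ' : ∀ T : geomTorsion W ((2 : ℕ) : ℤ), g • T = T := fun T ↦ by
      rw [← galoisRepTorsion_apply]
      have e2 : W.galoisRepTorsion ((2 : ℕ) : ℤ) g = 1 := hρ
      rw [e2]
      rfl
    -- `g` (and every Γ_K-conjugate of it) fixes `F` pointwise: it stabilises every `2`-torsion point and fixes `i`
    have hfixF : ∀ (ρ : absoluteGaloisGroup K) (x : AlgebraicClosure K),
        x ∈ IntermediateField.fixedField (MulAction.stabilizer (absoluteGaloisGroup K) P) ⊔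
          IntermediateField.adjoin K ({i} : Set (AlgebraicClosure K)) → (ρ⁻¹ * g * ρ) • x = x := by
      intro ρ x hx
      have hmem : absoluteGaloisGroup.toAlgEquiv K (ρ⁻¹ * g * ρ) ∈
          (IntermediateField.fixedField (MulAction.stabilizer (absoluteGaloisGroup K) P) ⊔
            IntermediateField.adjoin K ({i} : Set (AlgebraicClosure K))).fixingSubgroup := by
        rw [IntermediateField.fixingSubgroup_sup]
        refine ⟨?_, ?_⟩
        · -- `ρ⁻¹ g ρ ∈ Stab P ≤ fixingSubgroup (fixedField (Stab P))`
          have hst : ρ⁻¹ * g * ρ ∈ MulAction.stabilizer (absoluteGaloisGroup K) P := by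
            rw [MulAction.mem_stabilizer_iff, mul_smul, mul_smul, hρ' (ρ • P), inv_smul_smul]
          exact (IntermediateField.le_iff_le _ _).1 le_rfl hst
        · refine (FineSelmerUpstairs.mem_fixingSubgroup_adjoin_simple_iff i _).2 ?_
          rw [← absoluteGaloisGroup.smul_def]
          apply FineSelmerUpstairs.smul_eq_self_of_cyclotomicCharacter_eq_one i hi
          rw [map_mul, map_mul, hχ, mul_one, ← map_mul, inv_mul_cancel, map_one]
      rw [absoluteGaloisGroup.smul_def]
      exact (IntermediateField.mem_fixingSubgroup_iff _ _).1 hmem x hx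
    -- hence `g` fixes `e(F)`: `e` extends to some `σ ∈ Γ_K` with `e y = σ • y`
    have hrange : g ∈ (absGaloisRestrict K ↥(IntermediateField.fixedField (MulAction.stabilizer (absoluteGaloisGroup K) P) ⊔
        IntermediateField.adjoin K ({i} : Set (AlgebraicClosure K)))).range := by
      refine (he g).2 fun y ↦ ?_
      let eL : AlgebraicClosure K →ₐ[K] AlgebraicClosure K := e.liftNormal (AlgebraicClosure K)
      have heL : eL (y : AlgebraicClosure K) = e y := by
        have h := e.liftNormal_commutes (AlgebraicClosure K) y
        simpa using h
      let σ' : AlgebraicClosure K ≃ₐ[K] AlgebraicClosure K :=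
        AlgEquiv.ofBijective eL (Algebra.IsAlgebraic.algHom_bijective eL)
      set σ : absoluteGaloisGroup K := (absoluteGaloisGroup.toAlgEquiv K).symm σ' with hσdef
      have hσ : absoluteGaloisGroup.toAlgEquiv K σ = σ' := (absoluteGaloisGroup.toAlgEquiv K).apply_symm_apply σ'
      have hey : (e y : AlgebraicClosure K) = σ • (y : AlgebraicClosure K) := by
        rw [absoluteGaloisGroup.smul_def, hσ]
        exact heL.symm
      rw [hey, show g • σ • (y : AlgebraicClosure K) = σ • ((σ⁻¹ * g * σ) • (y : AlgebraicClosure K)) by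
        rw [mul_smul, mul_smul, smul_inv_smul], hfixF σ y y.2]
    unfold BaseChangeModel.galImage
    rw [resGal_eq_absGaloisRestrict, hkerF]
    change g ∈ Subgroup.map (absGaloisRestrict K _).toMonoidHom
      (Subgroup.comap (absGaloisRestrict K _).toMonoidHom κ.kerSubgroup)
    rw [Subgroup.map_comap_eq]
    refine Subgroup.mem_inf.2 ⟨hrange, ?_⟩
    rw [show κ.kerSubgroup = _ from hκ, Subgroup.mem_comap]
    change GaloisRep.cyclotomicCharacter K 2 g ∈ CommGroup.torsion ℤ_[2]ˣ
    rw [hχ]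
    exact (CommGroup.torsion ℤ_[2]ˣ).one_mem
  -- descend
  have hrel := finite_pTorsion_fineRelaxed_of_primewise_upstairs W 2 κ hNΩ hΩ (finiteIndex_upstairs_subgroupOf' W κ hκ) hup
  obtain ⟨γ₀, hγ₀⟩ : ∃ γ₀ : absoluteGaloisGroup K, κ.IsTopGenerator γ₀ := κ.surjective (Multiplicative.ofAdd 1)
  exact (IwasawaModuleFinitePadicInt.exists_fineSelmerDualData_moduleFinite_iff_finite_pTorsion W κ hγ₀).2
    (LimRelUpstairs.finite_pTorsion_fineSelmer_of_relaxed W κ hrel)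

end PointField

/-! ## §3 `K = ℚ`: the two classical-`μ` supply roads of Q⁺, without the Lim@2 print binder -/

section Cell

/-- **Q⁺ ⟸ Iw⁺, KERNEL** (no `hLim2`): Iwasawa's `μ₂ = 0` for the cyclotomic `ℤ₂`-extensions of `ℚ(W[2], √−1)` on the cell
(`ClassicalMuTwoDivisionFieldAdjoinIOrdPosDisc`, p699544) ⟹ Coates–Sujatha's (A) at `2` on the cell (`FineSelmerConjATwoOrdPosDisc`) — the lead
g6's `fineSelmerConjATwoOrdPosDisc_of_lim_of_classicalMu` with the Lim@2 binder DISCHARGED by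
`Lim2017.thm35_at_two_upstairs_fineSelmer_twoTorsion_finite_of_classicalMuVanishes_holds` (through the cell bsd-f1-sign2 descent
`LimRelUpstairs.exists_fineSelmerDualData_moduleFinite_of_lim2017`). Iw⁺ is an OPEN classical conjecture; nothing is asserted about it.
[cite: Lim2017FineSelmer, §3 Thm. 3.5 and Lemma 3.2] [cite: CoatesSujatha2005, Conj. A] [cite: Iwasawa1973MuInvariants, §1 (shape only)] -/
theorem fineSelmerConjATwoOrdPosDisc_of_classicalMuTwo (hIw : ClassicalMuTwoDivisionFieldAdjoinIOrdPosDisc) :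
    FineSelmerConjATwoOrdPosDisc := by
  intro W _ _ hcm hr hgo h2 hΔ κ hκ
  obtain ⟨i, hi⟩ := IsAlgClosed.exists_pow_nat_eq (-1 : AlgebraicClosure ℚ) two_pos
  exact LimRelUpstairs.exists_fineSelmerDualData_moduleFinite_of_lim2017 W κ
    Lim2017.thm35_at_two_upstairs_fineSelmer_twoTorsion_finite_of_classicalMuVanishes_holds i hi
    (hIw W hcm hr hgo h2 hΔ i hi) hκ

/-- **Q⁺ from Iwasawa's `μ₂ = 0` on the SMALL carrier `ℚ(P, √−1)`, KERNEL** (no `hLim2`): for every curve of the cell SOME non-zero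
`P ∈ W[2]` and SOME `i` with `i² = −1` such that every cyclotomic `ℤ₂`-extension of `ℚ(P, i) = ℚ̄^{Stab P} ⊔ ℚ⟮i⟯` (degree `6`, totally
imaginary) has classical `μ = 0` ⟹ Q⁺. The hypothesis is VERBATIM that of the lead g7's displayed road
`conjA_two_posDisc_of_lim_of_classicalMu_pointField` (p706268 `…PosDiscSmallCarrier`), whose other binder `hLim2` (print, and at this carrier
resting on Iwasawa's 1973 ascent) is no longer needed: §2. Per curve this is TWO class groups of degree-`6·2ⁿ` fields (Fukuda) — eng-2's
GREENBERG2 i-tower census. Nothing closed; Q⁺ and the `μ₂ = 0` input remain OPEN as `∀`-statements.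
[cite: Lim2017FineSelmer, §3 Thm. 3.5 and Lemma 3.2] [cite: CoatesSujatha2005, Conj. A and Thm. 3.4] [cite: Iwasawa1973MuInvariants, §1 (shape only)] -/
theorem fineSelmerConjATwoOrdPosDisc_of_classicalMu_pointField_adjoin_I
    (hIw : ∀ (W : WeierstrassCurve ℚ) [W.IsElliptic] [W.IsGloballyMinimal], ¬ W.HasCM → W.analyticRank = 0 →
      GoodOrd W 2 → W.HasSurjectiveModNGaloisRep 2 → 0 < W.Δ →
      ∃ (P : geomTorsion W 2) (i : AlgebraicClosure ℚ), P ≠ 0 ∧ i ^ 2 = -1 ∧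
        ∀ κL : ZpExtension
            ↥(IntermediateField.fixedField (MulAction.stabilizer (absoluteGaloisGroup ℚ) P) ⊔ IntermediateField.adjoin ℚ {i}) 2,
          κL.IsCyclotomic → ClassicalMuVanishes κL) :
    FineSelmerConjATwoOrdPosDisc := by
  intro W _ _ hcm hr hgo h2 hΔ κ hκ
  obtain ⟨P, i, hP, hi, hμ⟩ := hIw W hcm hr hgo h2 hΔ
  exact exists_fineSelmerDualData_moduleFinite_of_classicalMu_pointField_adjoin W hP hi hμ κ hκ

end Cell

end Summit.BirchSwinnertonDyer.BirchSwinnertonDyer.Theorems.SteinbergFibreAtTwo.PointFieldMu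

end
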